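/- WIDTH seat `ym-line-cbag-p1-w3` (prover-ym-line-cbag-p1-w3-g16-0; own items stmt-QuantumFields-22254 / 22893 CLOSED·proved), LINE 7
`GlueballBandRecursion`, in support of ⟨stmt-QuantumFields-22957⟩ `OneParticleBlochSymbolFamily` (= `Band.EffectiveBlochSymbolFamily`):
the SPECTRAL part of the planner's stub S4 (STUB-PLAN-22957, 2026-08-28T18:17Z) — an ISOLATED excited band of the transfer matrix (an
upper gap above the rest of the sub-dominant spectrum) carries the cold thermal trace at all LARGE Euclidean times with relative precision
`2`: the `m₀ ≤ m` branch of clause (P4) of the item.  Route-independent (no `Theses` import); definition-free; a helper. -/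
import Summits.QuantumFields.YangMills.Theorems.GlueballBandRecursionBlochTransfer
import Mathlib.Analysis.SpecificLimits.Basic

/-!
# Route `GlueballBandRecursion`, item `OneParticleBlochSymbolFamily` (stmt-QuantumFields-22957): an isolated band of the transfer
# matrix carries the thermal trace at large times (stub S4, spectral part)

Clause (P4) of `Band.EffectiveBlochSymbolFamily` asks for `½·Σ_p Re tr B̃(θ_p)^{m+2} ≤ traceExcess r.ρ β N (m+2) ≤ 2·Σ_p Re tr B̃(θ_p)^{m+2}`
(a) for all `m ≥ m₀` and (b) at the crux time `N/4 = m + 2`.  The lower halves are the landed variational floor (`sum_pow_div_le_traceExcess`,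
Bloch form `sum_re_trace_transferBloch_pow_le_traceExcess`).  THIS FILE proves the UPPER half of (a) from spectral information ALONE — the
output of the planner's stub S1 ("every eigenvector orthogonal to the band and to the ground state has eigenvalue `≤ Θ < min band`") — so
that the dilute-gas expansion of stub S4 is needed ONLY for (b), the crux time `t = ⌊N/4⌋ ≍ N` (where `m₀(β, N)` is of no use).

* §1 (abstract real Hilbert space; twin of `sum_pow_le_tsum_update_pow` of `…BandLevels.lean`): `T` symmetric, diagonal in a Hilbert basis
  `bᵢ` (`λᵢ ≥ 0`), top index `i₀`, a finite orthonormal eigenfamily `e_k` (`μ_k ≠ λ_{i₀}`).  `hasSum_update_pow_mul_defect`: the EXACT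
  SPLITTING `Σ_{i ≠ i₀} λᵢ^t = Σ_k μ_k^t + Σ_{i ≠ i₀} λᵢ^t·wᵢ`, `wᵢ = 1 − Σ_k ⟪bᵢ, e_k⟫² ∈ [0, 1]`; `eigenvalue_le_or_sum_inner_sq_eq_one`:
  under the UPPER GAP "every eigenvector `v ≠ 0` with `⟪b_{i₀}, v⟫ = 0`, `v ⊥ e_k ∀ k` has eigenvalue `≤ Θ`", each `i ≠ i₀` has `λᵢ ≤ Θ` or
  `wᵢ = 0`; `le_sum_pow_add_pow_mul_of_gap`: hence `Σ_{i ≠ i₀} λᵢ^t ≤ Σ_k μ_k^t + Θ^{t−s}·Σ_{i ≠ i₀} λᵢ^s` (`s ≤ t`, `Θ ≥ 0`);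
  `eigenvalue_lt_of_inner_eq_zero`: with a simple top, an eigenvector orthogonal to `b_{i₀}` has eigenvalue `< λ_{i₀}`.
* §2 (transfer matrix `𝕋 = wilsonTorusTransferMatrix r.ρ β N`, `λ₊ = transferSpectralRadius`, `x_t = traceExcess`, eigen-data
  `exists_eigenData_rate`; simple top from `q_N < 1`, `rate_lt_one_of_strongCoupling`).  For an orthonormal excited eigenfamily `e_k`
  (`μ_k < λ₊`) with the UPPER GAP "every eigenvector of `𝕋` with eigenvalue `< λ₊` orthogonal to all `e_k` has eigenvalue `≤ Θ`":
  `traceExcess_le_sum_pow_div_add_of_upperGap`: `x_{m+2} ≤ Σ_k (μ_k/λ₊)^{m+2} + (Θ/λ₊)^m·x_2` for EVERY `m`;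
  `exists_traceExcess_le_two_mul_sum_pow_div_of_upperGap`: `Θ < min_k μ_k ⟹ ∃ m₀, ∀ m ≥ m₀, x_{m+2} ≤ 2·Σ_k (μ_k/λ₊)^{m+2}`; and in the
  item's currency for the Bloch blocks of a covariant frame of the band (LEAD's `transfer_bloch_reduction`):
  `exists_traceExcess_le_two_mul_sum_re_trace_transferBloch_pow`, `exists_twoSided_cube_of_upperGap` (two-sided, `p ∈ (Fin N)³`).

Sources: folklore (Parseval/Bessel in an eigenbasis; Reed–Simon I Thm. VI.16; Montvay–Münster (1994) §3.2.6).  Deliberately NOT here: existence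
and isolation of the band (stub S1), the crux-time case `N/4 = m + 2` of (P4) (stub S4 proper, a dilute gas of glueball world-lines), the
smooth symbol (stub S3).

HONEST FRAMING.  Spectral bookkeeping for a conditional door.  Item ⟨stmt-QuantumFields-22957⟩, LINE 7's rung `ColdDoublingRecursionStrongCoupling`
(RECORD-type, strong coupling) and a fortiori the Yang–Mills mass gap / the summit `YangMills` are NOT proved or advanced here.
-/

set_option autoImplicit false

noncomputable section

open scoped InnerProductSpace BigOperators
open MeasureTheory Filter Topology
open Literature.MathematicalPhysics.QuantumFieldTheory
open Literature.MathematicalPhysics.QuantumFieldTheory.Balaban1983to89.Missing (strongCouplingRadius)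

namespace Summit.QuantumFields.YangMills.Theorems.GlueballBandRecursion.Band

/-! ### §1 Abstract: the exact splitting of a diagonal trace against a finite eigenfamily, and the upper gap -/

section Abstract

variable {E : Type*} [NormedAddCommGroup E] [InnerProductSpace ℝ E]

/-- Bessel for a unit vector against a finite orthonormal family: `Σ_k ⟪x, e_k⟫² ≤ 1`. [folklore] -/
theorem sum_inner_sq_le_one {P : Type*} [Fintype P] {e : P → E} (he : Orthonormal ℝ e) {x : E} (hx : ‖x‖ = 1) :
    ∑ p, ⟪x, e p⟫_ℝ ^ 2 ≤ 1 := by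
  have h := he.sum_inner_products_le x (s := Finset.univ)
  rw [hx, one_pow] at h
  refine le_trans (le_of_eq (Finset.sum_congr rfl fun p _ => ?_)) h
  rw [real_inner_comm (x) (e p), Real.norm_eq_abs, sq_abs]

variable {ι : Type*} (b : HilbertBasis ι ℝ E)

/-- **Exact splitting of a diagonal trace against a finite eigenfamily.**  `T` symmetric with `T bᵢ = λᵢ bᵢ` on a Hilbert basis,
a finite orthonormal eigenfamily `T e_k = μ_k e_k` with `μ_k ≠ λ_{i₀}`, and `Σ_{i ≠ i₀} λᵢ^t = X` (as the sum of `update (λ^t) i₀ 0`):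
then `X − Σ_k μ_k^t = Σ_{i ≠ i₀} λᵢ^t·(1 − Σ_k ⟪bᵢ, e_k⟫²)` (Parseval `μ_k^t = Σᵢ λᵢ^t ⟪bᵢ, e_k⟫²`, no weight on `i₀`). [folklore] -/
theorem hasSum_update_pow_mul_defect [DecidableEq ι] (T : E →L[ℝ] E) (hT : (T : E →ₗ[ℝ] E).IsSymmetric)
    (lam : ι → ℝ) (hb : ∀ i, T (b i) = lam i • b i) (i₀ : ι) (t : ℕ) {X : ℝ}
    (hX : HasSum (Function.update (fun i => lam i ^ t) i₀ 0) X)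
    {P : Type*} [Fintype P] (e : P → E) (he : Orthonormal ℝ e) (μ : P → ℝ)
    (hμ : ∀ p, T (e p) = μ p • e p) (hne : ∀ p, μ p ≠ lam i₀) :
    HasSum (fun i => Function.update (fun i => lam i ^ t) i₀ 0 i * (1 - ∑ p, ⟪b i, e p⟫_ℝ ^ 2))
      (X - ∑ p, μ p ^ t) := by
  -- Parseval for each `e p` in the eigenbasis: `Σᵢ ⟪bᵢ, e_p⟫² = 1`
  have hpar : ∀ p, HasSum (fun i => ⟪b i, e p⟫_ℝ ^ 2) 1 := by
    intro p
    have h := b.hasSum_inner_mul_inner (e p) (e p)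
    have h1 : ⟪e p, e p⟫_ℝ = 1 := by
      rw [real_inner_self_eq_norm_sq, he.1 p, one_pow]
    rw [h1] at h
    refine h.congr_fun fun i => ?_
    change ⟪b i, e p⟫_ℝ ^ 2 = ⟪e p, b i⟫_ℝ * ⟪b i, e p⟫_ℝ
    rw [real_inner_comm (b i) (e p), sq]
  -- support of the coefficients: `λᵢ ≠ μ_p ⟹ ⟪bᵢ, e_p⟫ = 0`
  have hsupp : ∀ i p, lam i ^ t * ⟪b i, e p⟫_ℝ ^ 2 = μ p ^ t * ⟪b i, e p⟫_ℝ ^ 2 := by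
    intro i p
    rcases eq_or_inner_eq_zero_of_eigen hT (x := b i) (e := e p) (l := lam i) (μ := μ p)
      (by simpa using hb i) (by simpa using hμ p) with h | h
    · rw [h]
    · rw [h]; ring
  have hc0 : ∀ p, ⟪b i₀, e p⟫_ℝ = 0 := fun p => by
    rcases eq_or_inner_eq_zero_of_eigen hT (x := b i₀) (e := e p) (l := lam i₀) (μ := μ p)
      (by simpa using hb i₀) (by simpa using hμ p) with h | h
    · exact absurd h.symm (hne p)
    · exact h
  -- `μ_p^t = Σᵢ (update λ^t i₀ 0)ᵢ ⟪bᵢ, e_p⟫²`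
  have hp : ∀ p, HasSum (fun i => Function.update (fun i => lam i ^ t) i₀ 0 i * ⟪b i, e p⟫_ℝ ^ 2) (μ p ^ t) := by
    intro p
    have h := (hpar p).mul_left (μ p ^ t)
    rw [mul_one] at h
    refine h.congr_fun fun i => ?_
    by_cases hi : i = i₀
    · subst hi; simp [hc0 p]
    · rw [Function.update_of_ne hi, hsupp i p]
  have hP : HasSum (fun i => ∑ p, Function.update (fun i => lam i ^ t) i₀ 0 i * ⟪b i, e p⟫_ℝ ^ 2)
      (∑ p, μ p ^ t) :=
    hasSum_sum fun p _ => hp p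
  refine (hX.sub hP).congr_fun fun i => ?_
  rw [mul_sub, mul_one, Finset.mul_sum]

/-- **The upper gap, basis form.**  If every eigenvector `v ≠ 0` of `T` orthogonal to `b_{i₀}` and to the whole family `(e_k)` has
eigenvalue `≤ Θ`, then for every `i ≠ i₀` either `λᵢ ≤ Θ` or `bᵢ` lies in the span of the family, `Σ_k ⟪bᵢ, e_k⟫² = 1` (test vector:
`v = bᵢ − Σ_k ⟪e_k, bᵢ⟫ e_k`, an eigenvector for `λᵢ` orthogonal to the family and to `b_{i₀}`). [folklore] -/
theorem eigenvalue_le_or_sum_inner_sq_eq_one (T : E →L[ℝ] E) (hT : (T : E →ₗ[ℝ] E).IsSymmetric)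
    (lam : ι → ℝ) (hb : ∀ i, T (b i) = lam i • b i) (i₀ : ι)
    {P : Type*} [Fintype P] (e : P → E) (he : Orthonormal ℝ e) (μ : P → ℝ)
    (hμ : ∀ p, T (e p) = μ p • e p) (hne : ∀ p, μ p ≠ lam i₀) {Θ : ℝ}
    (hgap : ∀ (v : E) (l : ℝ), v ≠ 0 → T v = l • v → ⟪b i₀, v⟫_ℝ = 0 → (∀ p, ⟪e p, v⟫_ℝ = 0) → l ≤ Θ)
    {i : ι} (hi : i ≠ i₀) :
    lam i ≤ Θ ∨ ∑ p, ⟪b i, e p⟫_ℝ ^ 2 = 1 := by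
  classical
  -- the component of `bᵢ` orthogonal to the family
  set v : E := b i - ∑ p, ⟪e p, b i⟫_ℝ • e p with hv
  have hortho : ∀ q, ⟪e q, v⟫_ℝ = 0 := by
    intro q
    have h1 : ⟪e q, ∑ p, ⟪e p, b i⟫_ℝ • e p⟫_ℝ = ⟪e q, b i⟫_ℝ := by
      rw [inner_sum]
      simp_rw [real_inner_smul_right]
      rw [Finset.sum_eq_single q]
      · rw [orthonormal_iff_ite.1 he q q, if_pos rfl, mul_one]
      · intro p _ hpq
        rw [orthonormal_iff_ite.1 he q p, if_neg (Ne.symm hpq), mul_zero]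
      · exact fun h => absurd (Finset.mem_univ q) h
    rw [hv, inner_sub_right, h1, sub_self]
  by_cases hv0 : v = 0
  · right
    have hbi : b i = ∑ p, ⟪e p, b i⟫_ℝ • e p := by
      rw [← sub_eq_zero]
      exact hv0
    have h2 : ⟪b i, ∑ p, ⟪e p, b i⟫_ℝ • e p⟫_ℝ = ∑ p, ⟪b i, e p⟫_ℝ ^ 2 := by
      rw [inner_sum]
      refine Finset.sum_congr rfl fun p _ => ?_
      rw [real_inner_smul_right, real_inner_comm (b i) (e p), sq]
    calc ∑ p, ⟪b i, e p⟫_ℝ ^ 2 = ⟪b i, ∑ p, ⟪e p, b i⟫_ℝ • e p⟫_ℝ := h2.symm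
      _ = ⟪b i, b i⟫_ℝ := by rw [← hbi]
      _ = 1 := by rw [real_inner_self_eq_norm_sq, b.orthonormal.1 i, one_pow]
  · left
    have hTe : ∀ p, ⟪e p, b i⟫_ℝ • T (e p) = lam i • (⟪e p, b i⟫_ℝ • e p) := by
      intro p
      rw [hμ p, smul_smul, smul_smul]
      rcases eq_or_inner_eq_zero_of_eigen hT (x := b i) (e := e p) (l := lam i) (μ := μ p)
        (by simpa using hb i) (by simpa using hμ p) with h | h
      · rw [h, mul_comm]
      · rw [real_inner_comm (e p) (b i)] at h
        rw [h, zero_mul, mul_zero]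
    have hTv : T v = lam i • v := by
      have h1 : T v = T (b i) - ∑ p, ⟪e p, b i⟫_ℝ • T (e p) := by
        simp only [hv, map_sub, map_sum, map_smul]
      rw [h1, hb i, Finset.sum_congr rfl fun p _ => hTe p, ← Finset.smul_sum, ← smul_sub]
    have hc0 : ∀ p, ⟪b i₀, e p⟫_ℝ = 0 := fun p => by
      rcases eq_or_inner_eq_zero_of_eigen hT (x := b i₀) (e := e p) (l := lam i₀) (μ := μ p)
        (by simpa using hb i₀) (by simpa using hμ p) with h | h
      · exact absurd h.symm (hne p)
      · exact h
    have h0 : ⟪b i₀, v⟫_ℝ = 0 := by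
      rw [hv, inner_sub_right, inner_sum]
      simp_rw [real_inner_smul_right, hc0, mul_zero, Finset.sum_const_zero, sub_zero]
      exact b.orthonormal.2 (Ne.symm hi)
    exact hgap v (lam i) hv0 hTv h0 hortho

/-- **The isolated family carries the diagonal trace up to a geometrically small remainder.**  With the data of
`hasSum_update_pow_mul_defect` at two times `s ≤ t` (`Σ_{i ≠ i₀} λᵢ^s = X_s`, `Σ_{i ≠ i₀} λᵢ^t = X_t`, `λᵢ ≥ 0`) and the basis form of the
upper gap (`λᵢ ≤ Θ` or `Σ_k ⟪bᵢ, e_k⟫² = 1` off `i₀`, `Θ ≥ 0`): `X_t ≤ Σ_k μ_k^t + Θ^{t−s}·X_s`. [folklore] -/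
theorem le_sum_pow_add_pow_mul_of_gap [DecidableEq ι] (T : E →L[ℝ] E) (hT : (T : E →ₗ[ℝ] E).IsSymmetric)
    (lam : ι → ℝ) (hb : ∀ i, T (b i) = lam i • b i) (hlam : ∀ i, 0 ≤ lam i) (i₀ : ι) {s t : ℕ} (hst : s ≤ t)
    {Xs Xt : ℝ} (hXs : HasSum (Function.update (fun i => lam i ^ s) i₀ 0) Xs)
    (hXt : HasSum (Function.update (fun i => lam i ^ t) i₀ 0) Xt)
    {P : Type*} [Fintype P] (e : P → E) (he : Orthonormal ℝ e) (μ : P → ℝ)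
    (hμ : ∀ p, T (e p) = μ p • e p) (hne : ∀ p, μ p ≠ lam i₀) {Θ : ℝ} (hΘ : 0 ≤ Θ)
    (hgap : ∀ i, i ≠ i₀ → lam i ≤ Θ ∨ ∑ p, ⟪b i, e p⟫_ℝ ^ 2 = 1) :
    Xt ≤ ∑ p, μ p ^ t + Θ ^ (t - s) * Xs := by
  have hDt := hasSum_update_pow_mul_defect b T hT lam hb i₀ t hXt e he μ hμ hne
  have hDs := hasSum_update_pow_mul_defect b T hT lam hb i₀ s hXs e he μ hμ hne
  have hw0 : ∀ i, 0 ≤ 1 - ∑ p, ⟪b i, e p⟫_ℝ ^ 2 := fun i =>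
    sub_nonneg.2 (sum_inner_sq_le_one he (b.orthonormal.1 i))
  have hw1 : ∀ i, 1 - ∑ p, ⟪b i, e p⟫_ℝ ^ 2 ≤ 1 := fun i =>
    sub_le_self _ (Finset.sum_nonneg fun p _ => sq_nonneg _)
  have hu : ∀ (n : ℕ) (i : ι), 0 ≤ Function.update (fun i => lam i ^ n) i₀ 0 i := by
    intro n i
    by_cases hi : i = i₀
    · subst hi; simp
    · rw [Function.update_of_ne hi]; exact pow_nonneg (hlam i) n
  -- termwise comparison of the two defect series
  have hterm : ∀ i, Function.update (fun i => lam i ^ t) i₀ 0 i * (1 - ∑ p, ⟪b i, e p⟫_ℝ ^ 2) ≤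
      Θ ^ (t - s) * (Function.update (fun i => lam i ^ s) i₀ 0 i * (1 - ∑ p, ⟪b i, e p⟫_ℝ ^ 2)) := by
    intro i
    by_cases hi : i = i₀
    · subst hi; simp
    · rw [Function.update_of_ne hi, Function.update_of_ne hi]
      rcases hgap i hi with h | h
      · have h1 : lam i ^ t ≤ Θ ^ (t - s) * lam i ^ s := by
          calc lam i ^ t = lam i ^ (t - s) * lam i ^ s := by rw [← pow_add, Nat.sub_add_cancel hst]
            _ ≤ Θ ^ (t - s) * lam i ^ s :=
              mul_le_mul_of_nonneg_right (pow_le_pow_left₀ (hlam i) h _) (pow_nonneg (hlam i) _)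
        calc lam i ^ t * (1 - ∑ p, ⟪b i, e p⟫_ℝ ^ 2)
            ≤ Θ ^ (t - s) * lam i ^ s * (1 - ∑ p, ⟪b i, e p⟫_ℝ ^ 2) := mul_le_mul_of_nonneg_right h1 (hw0 i)
          _ = Θ ^ (t - s) * (lam i ^ s * (1 - ∑ p, ⟪b i, e p⟫_ℝ ^ 2)) := mul_assoc _ _ _
      · rw [h, sub_self, mul_zero, mul_zero, mul_zero]
  have h1 : Xt - ∑ p, μ p ^ t ≤ Θ ^ (t - s) * (Xs - ∑ p, μ p ^ s) :=
    hasSum_le hterm hDt (hDs.mul_left _)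
  have h2 : Xs - ∑ p, μ p ^ s ≤ Xs :=
    hasSum_le (fun i => mul_le_of_le_one_right (hu s i) (hw1 i)) hDs hXs
  have h3 : Θ ^ (t - s) * (Xs - ∑ p, μ p ^ s) ≤ Θ ^ (t - s) * Xs :=
    mul_le_mul_of_nonneg_left h2 (pow_nonneg hΘ _)
  linarith

/-- **Simple top**: if `λᵢ < λ_{i₀}` off `i₀`, `T v = l v`, `v ≠ 0` and `⟪b_{i₀}, v⟫ = 0`, then `l < λ_{i₀}` (otherwise every coefficient
`⟪bᵢ, v⟫` vanishes and `v = 0` by Parseval). [folklore] -/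
theorem eigenvalue_lt_of_inner_eq_zero (T : E →L[ℝ] E) (hT : (T : E →ₗ[ℝ] E).IsSymmetric)
    (lam : ι → ℝ) (hb : ∀ i, T (b i) = lam i • b i) (i₀ : ι) (htop : ∀ i, i ≠ i₀ → lam i < lam i₀)
    {v : E} {l : ℝ} (hv : v ≠ 0) (hTv : T v = l • v) (h0 : ⟪b i₀, v⟫_ℝ = 0) : l < lam i₀ := by
  by_contra hl
  apply hv
  have hcoef : ∀ i, ⟪b i, v⟫_ℝ = 0 := by
    intro i
    by_cases hi : i = i₀
    · exact hi ▸ h0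
    · rcases eq_or_inner_eq_zero_of_eigen hT (x := b i) (e := v) (l := lam i) (μ := l)
        (by simpa using hb i) (by simpa using hTv) with h | h
      · exact absurd (h.symm.trans_lt (htop i hi)) hl
      · exact h
  have hrepr : b.repr v = 0 := by
    refine lp.ext (funext fun i => ?_)
    rw [b.repr_apply_apply, hcoef i]
    rfl
  exact b.repr.injective (by rw [hrepr, map_zero])

end Abstract

/-! ### §2 The transfer matrix: an isolated excited band carries the cold thermal trace at large times -/

section Transfer

variable {G : Type} [Group G] [TopologicalSpace G] [IsTopologicalGroup G] [CompactSpace G]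
  [MeasurableSpace G] [BorelSpace G]

/-- On the strong-coupling window the rate is `< 1` (`q_N ≤ e^{−1/2}`, `rate_le_exp_neg_half_of_strongCoupling`): the top of the
transfer-matrix spectrum is SIMPLE for every spatial period `N`. -/
theorem rate_lt_one_of_strongCoupling (r : LatticeRep G) {β : ℝ} (hβ0 : 0 ≤ β) (hβ : β ≤ strongCouplingRadius r.ρ)
    (N : ℕ) [NeZero N] :
    (⨅ k : ℕ, traceExcess r.ρ β N (k + 2) ^ ((1 : ℝ) / ((k : ℝ) + 2))) < 1 :=
  (rate_le_exp_neg_half_of_strongCoupling r hβ0 hβ N).trans_lt (Real.exp_lt_one_iff.2 (by norm_num))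

/- Standing data of §2: `β ≥ 0`, a period `N` with rate `q_N < 1` (simple top), a finite orthonormal family `e_k` of eigenvectors of
`𝕋 = wilsonTorusTransferMatrix r.ρ β N` with eigenvalues `μ_k < λ₊ = transferSpectralRadius r.ρ β N`, and the UPPER GAP below it:
every eigenvector of `𝕋` with eigenvalue `< λ₊` orthogonal to all `e_k` has eigenvalue `≤ Θ` (`Θ ≥ 0`). -/
variable (r : LatticeRep G) {β : ℝ} (hβ : 0 ≤ β) (N : ℕ) [NeZero N]
  (hq : (⨅ k : ℕ, traceExcess r.ρ β N (k + 2) ^ ((1 : ℝ) / ((k : ℝ) + 2))) < 1)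
  {K : Type*} [Fintype K] (e : K → Lp ℝ 2 (Measure.pi fun _ : Edge 3 N => haarProbability G)) (he : Orthonormal ℝ e)
  (μ : K → ℝ) (hμ : ∀ k, wilsonTorusTransferMatrix r.ρ β N (e k) = μ k • e k)
  (hlt : ∀ k, μ k < transferSpectralRadius r.ρ β N) {Θ : ℝ} (hΘ : 0 ≤ Θ)
  (hgap : ∀ (v : Lp ℝ 2 (Measure.pi fun _ : Edge 3 N => haarProbability G)) (l : ℝ), v ≠ 0 →
    wilsonTorusTransferMatrix r.ρ β N v = l • v → l < transferSpectralRadius r.ρ β N →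
    (∀ k, ⟪e k, v⟫_ℝ = 0) → l ≤ Θ)
include hβ hq he hμ hlt hΘ hgap

/-- **An isolated excited eigenfamily carries the thermal trace up to a geometric remainder.**  With the standing data of §2
(`β ≥ 0`, rate `q_N < 1` — automatic on the strong-coupling window, `rate_lt_one_of_strongCoupling` —, an orthonormal eigenfamily `e_k`
of `𝕋`, `μ_k < λ₊`, and the upper gap `Θ` below it), for EVERY Euclidean time `m + 2`:
`traceExcess r.ρ β N (m+2) ≤ Σ_k (μ_k/λ₊)^{m+2} + (Θ/λ₊)^m · traceExcess r.ρ β N 2` (§1 on the tree's eigen-data `exists_eigenData_rate`). -/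
theorem traceExcess_le_sum_pow_div_add_of_upperGap (m : ℕ) :
    traceExcess r.ρ β N (m + 2) ≤
      ∑ k, (μ k / transferSpectralRadius r.ρ β N) ^ (m + 2) +
        (Θ / transferSpectralRadius r.ρ β N) ^ m * traceExcess r.ρ β N 2 := by
  classical
  haveI : SecondCountableTopology G :=
    (r.continuous.isClosedEmbedding r.injective).isEmbedding.secondCountableTopology
  obtain ⟨s, _, b, lam, i₀, hb, hle, hL0, hrad, hx, hqi, -⟩ := exists_eigenData_rate r hβ N
  have hT := (isSelfAdjoint_wilsonTorusTransferMatrix N r.continuous r.mem_unitary β).isSymmetric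
  -- the trace formula in un-normalised form at every time `n + 2`
  have hx' : ∀ n : ℕ, HasSum (Function.update (fun i => lam i ^ (n + 2)) i₀ 0)
      (traceExcess r.ρ β N (n + 2) * lam i₀ ^ (n + 2)) := by
    intro n
    have h := (hx n).mul_right (lam i₀ ^ (n + 2))
    refine h.congr_fun fun i => ?_
    by_cases hi : i = i₀
    · subst hi; simp
    · rw [Function.update_of_ne hi, Function.update_of_ne hi, div_pow, div_mul_cancel₀ _ (pow_ne_zero _ hL0.ne')]
  have hx2 : HasSum (Function.update (fun i => lam i ^ 2) i₀ 0) (traceExcess r.ρ β N 2 * lam i₀ ^ 2) := by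
    simpa using hx' 0
  -- simplicity of the top: `λᵢ ≤ q_N·λ_{i₀} < λ_{i₀}` off `i₀`
  have htop : ∀ i, i ≠ i₀ → lam i < lam i₀ := fun i hi =>
    (hqi i hi).trans_lt (mul_lt_of_lt_one_left hL0 hq)
  have hne : ∀ k, μ k ≠ lam i₀ := fun k => by rw [← hrad]; exact (hlt k).ne
  -- the abstract upper gap (orthogonality to `b_{i₀}` replaces `eigenvalue < λ₊`)
  have hgap' : ∀ (v : Lp ℝ 2 (Measure.pi fun _ : Edge 3 N => haarProbability G)) (l : ℝ), v ≠ 0 →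
      wilsonTorusTransferMatrix r.ρ β N v = l • v → ⟪b i₀, v⟫_ℝ = 0 → (∀ k, ⟪e k, v⟫_ℝ = 0) → l ≤ Θ :=
    fun v l hv hTv h0 hortho =>
      hgap v l hv hTv (hrad ▸ eigenvalue_lt_of_inner_eq_zero b _ hT lam hb i₀ htop hv hTv h0) hortho
  have hgapb : ∀ i, i ≠ i₀ → lam i ≤ Θ ∨ ∑ k, ⟪b i, e k⟫_ℝ ^ 2 = 1 := fun i hi =>
    eigenvalue_le_or_sum_inner_sq_eq_one b _ hT lam hb i₀ e he μ hμ hne hgap' hi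
  have hmain := le_sum_pow_add_pow_mul_of_gap b _ hT lam hb (fun i => (hle i).1) i₀ (s := 2) (t := m + 2)
    (by omega) hx2 (hx' m) e he μ hμ hne hΘ hgapb
  rw [show m + 2 - 2 = m from by omega] at hmain
  -- divide by `λ_{i₀}^{m+2}`
  rw [hrad]
  refine ((le_div_iff₀ (pow_pos hL0 (m + 2))).2 hmain).trans (le_of_eq ?_)
  rw [add_div, Finset.sum_div]
  congr 1
  · exact Finset.sum_congr rfl fun k _ => (div_pow _ _ _).symm
  · rw [div_pow, pow_add]
    field_simp

/-- **An isolated excited band carries the thermal trace at large times, with relative precision `2`.**  With the standing data of §2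
and a non-empty band with a STRICT gap `Θ < μ_k ∀ k`: `∃ m₀` (depending on `β`, `N`, the band, `Θ`) with `traceExcess r.ρ β N (m+2) ≤
2·Σ_k (μ_k/λ₊)^{m+2}` for all `m ≥ m₀` (`(Θ/min μ)^m·x_2 → 0`) — the `m₀ ≤ m` branch of the upper half of (P4), from isolation ALONE. -/
theorem exists_traceExcess_le_two_mul_sum_pow_div_of_upperGap [Nonempty K] (hΘμ : ∀ k, Θ < μ k) :
    ∃ m₀ : ℕ, ∀ m : ℕ, m₀ ≤ m →
      traceExcess r.ρ β N (m + 2) ≤ 2 * ∑ k, (μ k / transferSpectralRadius r.ρ β N) ^ (m + 2) := by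
  obtain ⟨k₀, hk₀⟩ := Finite.exists_min μ
  set Λ : ℝ := transferSpectralRadius r.ρ β N with hΛdef
  have hμ0 : 0 < μ k₀ := hΘ.trans_lt (hΘμ k₀)
  have hΛ : 0 < Λ := hμ0.trans (hlt k₀)
  have hratio : Θ / μ k₀ < 1 := (div_lt_one hμ0).2 (hΘμ k₀)
  have hlim : Tendsto (fun m : ℕ => (Θ / μ k₀) ^ m * (traceExcess r.ρ β N 2 * Λ ^ 2)) atTop (𝓝 0) := by
    have h := (tendsto_pow_atTop_nhds_zero_of_lt_one (div_nonneg hΘ hμ0.le) hratio).mul_const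
      (traceExcess r.ρ β N 2 * Λ ^ 2)
    rwa [zero_mul] at h
  obtain ⟨m₀, hm₀⟩ := eventually_atTop.1 (hlim.eventually_le_const (pow_pos hμ0 2))
  refine ⟨m₀, fun m hm => ?_⟩
  have h1 := traceExcess_le_sum_pow_div_add_of_upperGap r hβ N hq e he μ hμ hlt hΘ hgap m
  -- the remainder is below the smallest band term
  have h' : Θ ^ m * (traceExcess r.ρ β N 2 * Λ ^ 2) ≤ μ k₀ ^ (m + 2) := by
    have h := mul_le_mul_of_nonneg_right (hm₀ m hm) (pow_nonneg hμ0.le m)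
    have hμ0' : μ k₀ ≠ 0 := hμ0.ne'
    calc Θ ^ m * (traceExcess r.ρ β N 2 * Λ ^ 2)
        = (Θ / μ k₀) ^ m * (traceExcess r.ρ β N 2 * Λ ^ 2) * μ k₀ ^ m := by rw [div_pow]; field_simp
      _ ≤ μ k₀ ^ 2 * μ k₀ ^ m := h
      _ = μ k₀ ^ (m + 2) := by ring
  have h2 : (Θ / Λ) ^ m * traceExcess r.ρ β N 2 ≤ (μ k₀ / Λ) ^ (m + 2) := by
    rw [div_pow, div_pow, div_mul_eq_mul_div, div_le_div_iff₀ (pow_pos hΛ m) (pow_pos hΛ (m + 2))]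
    calc Θ ^ m * traceExcess r.ρ β N 2 * Λ ^ (m + 2) = Θ ^ m * (traceExcess r.ρ β N 2 * Λ ^ 2) * Λ ^ m := by ring
      _ ≤ μ k₀ ^ (m + 2) * Λ ^ m := mul_le_mul_of_nonneg_right h' (pow_nonneg hΛ.le m)
  have h3 : (μ k₀ / Λ) ^ (m + 2) ≤ ∑ k, (μ k / Λ) ^ (m + 2) :=
    Finset.single_le_sum (f := fun k => (μ k / Λ) ^ (m + 2))
      (fun k _ => pow_nonneg (div_nonneg (hΘ.trans (hΘμ k).le) hΛ.le) _) (Finset.mem_univ k₀)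
  linarith

/- The band as a translation-covariant frame `ψ` (the LEAD's `transfer_bloch_reduction` data): `ψ` orthonormal, covariant under the
Koopman translations, spanning a `𝕋`-invariant subspace of which `e_k` is an orthonormal eigenbasis. -/
variable {n : ℕ} {ψ : Site 3 N × Fin n → Lp ℝ 2 (Measure.pi fun _ : Edge 3 N => haarProbability G)} (hψ : Orthonormal ℝ ψ)
  (hcov : ∀ (v x : Site 3 N) (j : Fin n), ψ (v + x, j) = koopmanTranslate N v (ψ (x, j)))
  (hinv : ∀ b, wilsonTorusTransferMatrix r.ρ β N (ψ b) ∈ Submodule.span ℝ (Set.range ψ))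
  (he_mem : ∀ k, e k ∈ Submodule.span ℝ (Set.range ψ)) (hψ_mem : ∀ a, ψ a ∈ Submodule.span ℝ (Set.range e))
include hψ hcov hinv he_mem hψ_mem

/-- **The upper half of (P4) at large times, in Bloch currency.**  For a translation-covariant orthonormal frame `ψ` of the band, an
orthonormal eigenbasis `e_k` of its span (`μ_k < λ₊`), `q_N < 1` and the strict upper gap `Θ < min_k μ_k`:
`∃ m₀, ∀ m ≥ m₀, traceExcess r.ρ β N (m+2) ≤ 2·Σ_{p ∈ (ℤ/N)³} Re tr B̂(p)^{m+2}`, `B̂ = transferBloch r β N ψ` (`transfer_bloch_reduction`). -/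
theorem exists_traceExcess_le_two_mul_sum_re_trace_transferBloch_pow [Nonempty K] (hΘμ : ∀ k, Θ < μ k) :
    ∃ m₀ : ℕ, ∀ m : ℕ, m₀ ≤ m →
      traceExcess r.ρ β N (m + 2) ≤ 2 * ∑ p : Site 3 N, ((transferBloch r β N ψ p ^ (m + 2)).trace).re := by
  obtain ⟨m₀, h⟩ := exists_traceExcess_le_two_mul_sum_pow_div_of_upperGap r hβ N hq e he μ hμ hlt hΘ hgap hΘμ
  refine ⟨m₀, fun m hm => ?_⟩
  rw [← transfer_bloch_reduction r β N hψ hcov hinv he hμ he_mem hψ_mem (m + 2)]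
  exact h m hm

/-- **Two-sided (P4) at large times for the exact Bloch blocks, item indexing `p ∈ (Fin N)³`.**  Under the same hypotheses:
`∃ m₀, ∀ m ≥ m₀, ½·Σ_p Re tr B̂(cubeToSite p)^{m+2} ≤ traceExcess r.ρ β N (m+2) ≤ 2·Σ_p Re tr B̂(cubeToSite p)^{m+2}` — the `m₀ ≤ m`
branch of clause (P4) for `B̃(latticeAngle N p) := B̂(cubeToSite p)` (lower half: the landed floor).  The crux time `N/4 = m + 2` is NOT touched. -/
theorem exists_twoSided_cube_of_upperGap [Nonempty K] (hΘμ : ∀ k, Θ < μ k) :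
    ∃ m₀ : ℕ, ∀ m : ℕ, m₀ ≤ m →
      (1 / 2 : ℝ) * ∑ p : Fin N × Fin N × Fin N, ((transferBloch r β N ψ (cubeToSite p) ^ (m + 2)).trace).re ≤
          traceExcess r.ρ β N (m + 2) ∧
        traceExcess r.ρ β N (m + 2) ≤
          2 * ∑ p : Fin N × Fin N × Fin N, ((transferBloch r β N ψ (cubeToSite p) ^ (m + 2)).trace).re := by
  obtain ⟨m₀, h⟩ := exists_traceExcess_le_two_mul_sum_pow_div_of_upperGap r hβ N hq e he μ hμ hlt hΘ hgap hΘμ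
  refine ⟨m₀, fun m hm => ?_⟩
  have hsum : ∑ p : Fin N × Fin N × Fin N, ((transferBloch r β N ψ (cubeToSite p) ^ (m + 2)).trace).re =
      ∑ k, (μ k / transferSpectralRadius r.ρ β N) ^ (m + 2) := by
    rw [Fintype.sum_equiv cubeEquivSite (fun p => ((transferBloch r β N ψ (cubeToSite p) ^ (m + 2)).trace).re)
      (fun v => ((transferBloch r β N ψ v ^ (m + 2)).trace).re) (fun p => rfl),
      transfer_bloch_reduction r β N hψ hcov hinv he hμ he_mem hψ_mem (m + 2)]
  have hS : 0 ≤ ∑ k, (μ k / transferSpectralRadius r.ρ β N) ^ (m + 2) :=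
    Finset.sum_nonneg fun k _ => pow_nonneg (div_nonneg (hΘ.trans (hΘμ k).le)
      ((hΘ.trans (hΘμ k).le).trans (hlt k).le)) _
  have hlow := sum_pow_div_le_traceExcess r hβ N e he μ hμ hlt m
  rw [hsum]
  exact ⟨by linarith, h m hm⟩

end Transfer

end Summit.QuantumFields.YangMills.Theorems.GlueballBandRecursion.Band

end
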